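import Literature.Probability.LatticeModels.IsingPlusEdwardsSokalNPoint
import HarnessLib

/-!
# Edwards–Sokal with plus boundary conditions, `n`-point version on boxes of `ℤ^d`:
# `⟨∏ⱼ σ_{xⱼ}⟩⁺_{Λ_L;β} = φ¹_{Λ_{L+1},p,2}(∀ j, xⱼ ↮ ∂Λ_{L+1} → #{i | xⱼ ↔ xᵢ} even)`

Topic `Literature/Probability/LatticeModels`. The `n`-point analogue of
`isingCorr_plus_box_eq_rcMeasure_real` / `thetaWiredBox_succ_eq_isingCorr_plus`
(`IsingPlusEdwardsSokal`; G. Grimmett, *The Random-Cluster Model* (2006), Thm. 1.16 with §4.2,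
(4.12)–(4.13); Edwards–Sokal 1988), for marked points `x₀, …, x_{n-1} ∈ Λ_{L+1}` (repetitions
allowed), built on the count of `IsingPlusEdwardsSokalNPoint`:

* `isingExpect_plus_box_spinMonomial_eq_rcMeasure_touch`: expanding the Boltzmann weight over edge
  sets exactly as in the one-point file,
  `⟨∏ⱼ σ_{xⱼ}⟩⁺_{Λ_L;β,0} = φ^{∂Λ_{L+1}}_{⟨ℰ^b_{Λ_L}⟩,p,2}(E_x)`, `p = 1 - e^{-2β}`, where `E_x` is the
  event "for every `j` with `xⱼ ↮ ∂Λ_{L+1}`, the number of `i` with `xⱼ ↔ xᵢ` is even";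
* `isingExpect_plus_box_spinMonomial_eq_rcMeasure_real`: the same with the random-cluster measure
  of the full box graph `Λ_{L+1}` wired on `∂Λ_{L+1}` (the ring edges are integrated out by
  `rcMeasure_real_eq_fromEdgeSet_of_outside_wired`; the event `E_x` does not see them,
  `reachable_inter_touchEdges_of_not_reachable_boxBoundary`).

Not here: the infinite-volume limit `L → ∞` (which uses `m*(β_c) = 0`).

## References

* G. Grimmett, *The Random-Cluster Model*, Springer 2006: §1.4 Thm. 1.16 (and its proof),
  §4.2 (4.12)–(4.13), Prop. (5.11) (proof) — bib key `Grimmett2006`.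
* R. G. Edwards, A. D. Sokal, Phys. Rev. D 38 (1988) 2009–2012 — bib key `EdwardsSokal1988`.
-/

noncomputable section

namespace Literature.Probability.LatticeModels

open MeasureTheory Finset SimpleGraph
open Literature.Barriers.CriticalPhenomena

/-! ### The `n`-point identity on the plus-boundary box -/

section Box

variable {d L : ℕ}

/-- Exchange of the configuration sum and the edge-set sum, with the plus constraint (local copy of
the private lemma of `IsingPlusEdwardsSokal`). [cite: Grimmett2006, §1.4 Thm. 1.16 (proof)] -/
private theorem sum_ite_mul_sum_exchange' {ι κ : Type*} [Fintype ι] (t : Finset κ) (c : ℝ)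
    (Wt : κ → ℝ) (P : ι → Prop) [DecidablePred P] (Fc : ι → κ → Prop) [∀ i k, Decidable (Fc i k)]
    (s : ι → ℝ) :
    ∑ i, (if P i then (c * ∑ k ∈ t, Wt k * (if Fc i k then 1 else 0)) * s i else 0) =
      c * ∑ k ∈ t, Wt k * ∑ i, (if P i ∧ Fc i k then (1 : ℝ) else 0) * s i := by
  have step : ∀ i, (if P i then (c * ∑ k ∈ t, Wt k * (if Fc i k then 1 else 0)) * s i else 0) =
      ∑ k ∈ t, c * (Wt k * ((if P i ∧ Fc i k then (1 : ℝ) else 0) * s i)) := by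
    intro i
    by_cases hP : P i
    · simp only [hP, if_true, true_and, Finset.mul_sum, Finset.sum_mul]
      refine Finset.sum_congr rfl fun k _ => ?_
      ring
    · simp only [hP, if_false, false_and, zero_mul, mul_zero, Finset.sum_const_zero]
  calc ∑ i, (if P i then (c * ∑ k ∈ t, Wt k * (if Fc i k then 1 else 0)) * s i else 0)
      = ∑ i, ∑ k ∈ t, c * (Wt k * ((if P i ∧ Fc i k then (1 : ℝ) else 0) * s i)) :=
        Finset.sum_congr rfl fun i _ => step i
    _ = ∑ k ∈ t, ∑ i, c * (Wt k * ((if P i ∧ Fc i k then (1 : ℝ) else 0) * s i)) := Finset.sum_comm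
    _ = c * ∑ k ∈ t, Wt k * ∑ i, (if P i ∧ Fc i k then (1 : ℝ) else 0) * s i := by
        rw [Finset.mul_sum]
        refine Finset.sum_congr rfl fun k _ => ?_
        rw [Finset.mul_sum, Finset.mul_sum]

/-- **`n`-point Edwards–Sokal with plus boundary conditions, on the touching graph** (Grimmett 2006,
Thm. 1.16 and §4.2, (4.12), for `q = 2` with Ising spins `±1`, run with `n` marked points;
Edwards–Sokal 1988): for `β ≥ 0`, `d ≥ 1` and marked points `x₀, …, x_{n-1} ∈ Λ_{L+1}`
(repetitions allowed), `⟨∏ⱼ σ_{xⱼ}⟩⁺_{Λ_L;β,0}` equals the probability, under the random-cluster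
measure with `p = 1 - e^{-2β}`, `q = 2` of the spanning graph of `Λ_{L+1}` with edge set `ℰ^b_{Λ_L}`
wired on `∂Λ_{L+1}`, that every `xⱼ` NOT joined to `∂Λ_{L+1}` by an open path is joined to an even
number of the `xᵢ` (counted with multiplicity, `i = j` included).
[cite: Grimmett2006, Thm. 1.16 and §4.2 eq. (4.12); EdwardsSokal1988] -/
theorem isingExpect_plus_box_spinMonomial_eq_rcMeasure_touch (hd : 0 < d) {β : ℝ} (hβ : 0 ≤ β)
    (L : ℕ) {n : ℕ} (x : Fin n → Site d) (hx : ∀ j, x j ∈ box d (L + 1)) :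
    isingExpect (zdGraph d) (box d L) β 0 .plus (spinMonomial x) =
      (rcMeasure (touchGraph d L) (fkIsingParam β) 2 (boxBoundary d (L + 1))).real
        {ω | ∀ j, (¬ ∃ y ∈ boxBoundary d (L + 1), (Percolation.openGraph ω).Reachable ⟨x j, hx j⟩ y) →
          Even {i | (Percolation.openGraph ω).Reachable ⟨x j, hx j⟩ ⟨x i, hx i⟩}.ncard} := by
  classical
  set W := boxBoundary d (L + 1) with hW
  set a : Fin n → BoxV d (L + 1) := fun j => ⟨x j, hx j⟩ with ha
  set T := touchEdges d L with hT
  set p := fkIsingParam β with hpdef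
  set A : Set (Percolation.BondConfig (BoxV d (L + 1))) :=
    {ω | ∀ j, (¬ ∃ y ∈ W, (Percolation.openGraph ω).Reachable (a j) y) →
      Even {i | (Percolation.openGraph ω).Reachable (a j) (a i)}.ncard} with hA
  have hWne : W.Nonempty := by
    obtain ⟨z, hz⟩ := innerBoundary_box_nonempty hd (L + 1)
    exact ⟨⟨z, (mem_innerBoundary_iff.1 hz).1⟩, hz⟩
  have hp : p ∈ Set.Icc (0 : ℝ) 1 := fkIsingParam_mem_Icc hβ
  have hq : (0 : ℝ) < 2 := two_pos
  have hET : (touchGraph d L).edgeFinset = T := edgeFinset_touchGraph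
  have hc : (0 : ℝ) < Real.exp β ^ #T := pow_pos (Real.exp_pos β) _
  -- the weights
  set Wt : Finset (Sym2 (BoxV d (L + 1))) → ℝ := fun ω => p ^ #ω * (1 - p) ^ #(T \ ω) with hWt
  set K : Finset (Sym2 (BoxV d (L + 1))) → ℕ :=
    fun ω => clusterCount (↑ω : Percolation.BondConfig (BoxV d (L + 1))) W with hK
  haveI : Nonempty (BoxV d (L + 1)) := ⟨boxOrigin d (L + 1)⟩
  have h2K : ∀ ω, (2 : ℝ) ^ K ω = 2 * 2 ^ (K ω - 1) := by
    intro ω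
    have hpos : 0 < K ω := clusterCount_pos _ _
    conv_lhs => rw [show K ω = (K ω - 1) + 1 by omega, pow_succ]
    ring
  -- the observable on the closed box
  have hmono : ∀ τ : ↥(box d L) → ℤˣ,
      spinMonomial x (glue (box d L) τ .plus) = spinMonomial a (plusExt d L τ) := by
    intro τ
    unfold spinMonomial
    exact Finset.prod_congr rfl fun j _ => spinAt_glue_plus τ (a j)
  -- the Ising side as a ratio of finite sums over interior configurations
  have hL : isingExpect (zdGraph d) (box d L) β 0 .plus (spinMonomial x) =
      (∑ τ : ↥(box d L) → ℤˣ, isingWeight (zdGraph d) (box d L) β 0 .plus τ *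
          spinMonomial x (glue (box d L) τ .plus)) /
        ∑ τ : ↥(box d L) → ℤˣ, isingWeight (zdGraph d) (box d L) β 0 .plus τ := by
    rw [isingExpect, integral_isingMeasure _ _ _ _ _ (measurable_spinMonomial x),
      isingPartitionFunction]
  -- both sums transferred to the closed box and expanded over edge sets
  have hexp : ∀ σ : SpinConfig (BoxV d (L + 1)), Real.exp (β * ∑ e ∈ T, bondSpin σ e) =
      Real.exp β ^ #T * ∑ ω ∈ T.powerset, Wt ω * (if ∀ e ∈ ω, bondSpin σ e = 1 then 1 else 0) := by
    intro σ
    have h := exp_mul_sum_bondSpin_eq (touchGraph d L) β σ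
    rw [hET] at h
    rw [h]
  have hNum : ∑ τ : ↥(box d L) → ℤˣ, isingWeight (zdGraph d) (box d L) β 0 .plus τ *
        spinMonomial x (glue (box d L) τ .plus) =
      Real.exp β ^ #T * ∑ ω ∈ T.powerset, Wt ω *
        ∑ σ : SpinConfig (BoxV d (L + 1)),
          (if (∀ w ∈ W, σ w = 1) ∧ ∀ e ∈ ω, bondSpin σ e = 1 then (1 : ℝ) else 0) *
            spinMonomial a σ := by
    have h1 : ∀ τ : ↥(box d L) → ℤˣ, isingWeight (zdGraph d) (box d L) β 0 .plus τ *
          spinMonomial x (glue (box d L) τ .plus) =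
        (fun σ => Real.exp (β * ∑ e ∈ T, bondSpin σ e) * spinMonomial a σ) (plusExt d L τ) := by
      intro τ
      simp only [isingWeight_plus_box_eq, ← hT, hmono τ]
    simp_rw [h1]
    have h2 := sum_plusExt_eq (d := d) (n := L)
      (fun σ => Real.exp (β * ∑ e ∈ T, bondSpin σ e) * spinMonomial a σ)
    rw [h2]
    simp_rw [hexp]
    exact sum_ite_mul_sum_exchange' _ _ _ _ _ _
  have hDen : ∑ τ : ↥(box d L) → ℤˣ, isingWeight (zdGraph d) (box d L) β 0 .plus τ =
      Real.exp β ^ #T * ∑ ω ∈ T.powerset, Wt ω *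
        ∑ σ : SpinConfig (BoxV d (L + 1)),
          (if (∀ w ∈ W, σ w = 1) ∧ ∀ e ∈ ω, bondSpin σ e = 1 then (1 : ℝ) else 0) * 1 := by
    have h1 : ∀ τ : ↥(box d L) → ℤˣ, isingWeight (zdGraph d) (box d L) β 0 .plus τ =
        (fun σ => Real.exp (β * ∑ e ∈ T, bondSpin σ e) * 1) (plusExt d L τ) := by
      intro τ
      simp only [isingWeight_plus_box_eq, ← hT, mul_one]
    simp_rw [h1]
    have h2 := sum_plusExt_eq (d := d) (n := L) (fun σ => Real.exp (β * ∑ e ∈ T, bondSpin σ e) * 1)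
    rw [h2]
    simp_rw [hexp]
    exact sum_ite_mul_sum_exchange' _ _ _ _ _ (fun _ => 1)
  -- evaluate the configuration sums
  have hNum' : ∑ τ : ↥(box d L) → ℤˣ, isingWeight (zdGraph d) (box d L) β 0 .plus τ *
        spinMonomial x (glue (box d L) τ .plus) =
      Real.exp β ^ #T * ∑ ω ∈ T.powerset, Wt ω * ((2 : ℝ) ^ (K ω - 1) *
        (if (↑ω : Percolation.BondConfig (BoxV d (L + 1))) ∈ A then 1 else 0)) := by
    rw [hNum]
    refine congrArg (Real.exp β ^ #T * ·) (Finset.sum_congr rfl fun ω _ => ?_)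
    refine congrArg (Wt ω * ·) ?_
    by_cases hAω : (↑ω : Percolation.BondConfig (BoxV d (L + 1))) ∈ A
    · rw [if_pos hAω, mul_one]
      exact sum_boole_plus_bondSpin_mul_spinMonomial_of_even ω hWne a hAω
    · rw [if_neg hAω, mul_zero]
      exact sum_boole_plus_bondSpin_mul_spinMonomial_of_not_even ω a hAω
  have hDen' : ∑ τ : ↥(box d L) → ℤˣ, isingWeight (zdGraph d) (box d L) β 0 .plus τ =
      Real.exp β ^ #T * ∑ ω ∈ T.powerset, Wt ω * (2 : ℝ) ^ (K ω - 1) := by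
    rw [hDen]
    refine congrArg (Real.exp β ^ #T * ·) (Finset.sum_congr rfl fun ω _ => ?_)
    refine congrArg (Wt ω * ·) ?_
    simp only [mul_one]
    exact sum_boole_plus_bondSpin_eq ω hWne
  -- the random-cluster side
  have hR : (rcMeasure (touchGraph d L) p 2 W).real A =
      (∑ ω ∈ T.powerset, if (↑ω : Percolation.BondConfig (BoxV d (L + 1))) ∈ A then
          Wt ω * (2 : ℝ) ^ K ω else 0) /
        ∑ ω ∈ T.powerset, Wt ω * (2 : ℝ) ^ K ω := by
    have hw : ∀ ω, rcWeight (touchGraph d L) p 2 W ω = Wt ω * (2 : ℝ) ^ K ω := by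
      intro ω
      rw [rcWeight, hET]
    rw [rcMeasure_real_eq_sum_div _ hp hq, rcPartitionFunction, hET]
    simp only [hw]
  -- compare
  rw [hL, hNum', hDen', mul_div_mul_left _ _ hc.ne', hR]
  have e1 : ∑ ω ∈ T.powerset, (if (↑ω : Percolation.BondConfig (BoxV d (L + 1))) ∈ A then
        Wt ω * (2 : ℝ) ^ K ω else 0) =
      2 * ∑ ω ∈ T.powerset, Wt ω * ((2 : ℝ) ^ (K ω - 1) *
        (if (↑ω : Percolation.BondConfig (BoxV d (L + 1))) ∈ A then 1 else 0)) := by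
    rw [Finset.mul_sum]
    refine Finset.sum_congr rfl fun ω _ => ?_
    rw [h2K]
    split_ifs <;> ring
  have e2 : ∑ ω ∈ T.powerset, Wt ω * (2 : ℝ) ^ K ω =
      2 * ∑ ω ∈ T.powerset, Wt ω * (2 : ℝ) ^ (K ω - 1) := by
    rw [Finset.mul_sum]
    refine Finset.sum_congr rfl fun ω _ => ?_
    rw [h2K]
    ring
  rw [e1, e2, mul_div_mul_left _ _ (two_ne_zero)]

/-- **Off the wired boundary, open paths use touching edges only**: if `x ∈ Λ_{L+1}` is not joined
to `∂Λ_{L+1}` by an open path of `ω ⊆ E_{Λ_{L+1}}`, every open path from `x` avoids `∂Λ_{L+1}`,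
hence consists of edges touching `Λ_L` and survives the removal of the ring edges.
[cite: Grimmett2006, Prop. (5.11) (proof)] -/
theorem reachable_inter_touchEdges_of_not_reachable_boxBoundary
    {ω : Finset (Sym2 (BoxV d (L + 1)))} (hω : ω ⊆ (boxGraph d (L + 1)).edgeFinset)
    {x y : BoxV d (L + 1)}
    (hx : ¬ ∃ z ∈ boxBoundary d (L + 1),
      (Percolation.openGraph (↑ω : Percolation.BondConfig (BoxV d (L + 1)))).Reachable x z)
    (h : (Percolation.openGraph (↑ω : Percolation.BondConfig (BoxV d (L + 1)))).Reachable x y) :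
    (Percolation.openGraph (↑(ω ∩ touchEdges d L) :
      Percolation.BondConfig (BoxV d (L + 1)))).Reachable x y := by
  classical
  obtain ⟨p⟩ := h
  induction p with
  | nil => exact Reachable.refl _
  | @cons a b c hadj p' ih =>
    have ha : a ∉ boxBoundary d (L + 1) := fun ha => hx ⟨a, ha, Reachable.refl _⟩
    have han : a.1 ∈ box d L := not_not.1 (mt (mem_boxBoundary_iff_notMem a).2 ha)
    have hb : ¬ ∃ z ∈ boxBoundary d (L + 1),
        (Percolation.openGraph (↑ω : Percolation.BondConfig (BoxV d (L + 1)))).Reachable b z :=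
      fun ⟨z, hz, hbz⟩ => hx ⟨z, hz, hadj.reachable.trans hbz⟩
    rw [Percolation.openGraph_adj, Finset.mem_coe] at hadj
    have hT : s(a, b) ∈ touchEdges d L := by
      rw [touchEdges, Finset.mem_filter]
      exact ⟨hω hadj.1, a, Sym2.mem_mk_left _ _, han⟩
    have hstep : (Percolation.openGraph (↑(ω ∩ touchEdges d L) :
        Percolation.BondConfig (BoxV d (L + 1)))).Adj a b := by
      rw [Percolation.openGraph_adj, Finset.mem_coe, Finset.mem_inter]
      exact ⟨⟨hadj.1, hT⟩, hadj.2⟩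
    exact hstep.reachable.trans (ih hb)

/-- **`n`-point Edwards–Sokal with plus boundary conditions, on the wired box** (Grimmett 2006,
Thm. 1.16 with §4.2 (4.12)–(4.13); Edwards–Sokal 1988): for `β ≥ 0`, `d ≥ 1` and
`x₀, …, x_{n-1} ∈ Λ_{L+1}`,
`⟨∏ⱼ σ_{xⱼ}⟩⁺_{Λ_L;β,0} = φ¹_{Λ_{L+1},p,2}(∀ j, xⱼ ↮ ∂Λ_{L+1} → #{i | xⱼ ↔ xᵢ} even)`, `p = 1 - e^{-2β}`,
the random-cluster measure being that of the full box graph `Λ_{L+1}` wired on `∂Λ_{L+1}`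
(the ring edges are integrated out by the domain Markov property with wired outside,
`rcMeasure_real_eq_fromEdgeSet_of_outside_wired`; the event does not depend on them).
[cite: Grimmett2006, Thm. 1.16 and §4.2 eqs. (4.12)–(4.13)] -/
theorem isingExpect_plus_box_spinMonomial_eq_rcMeasure_real (hd : 0 < d) {β : ℝ} (hβ : 0 ≤ β)
    (L : ℕ) {n : ℕ} (x : Fin n → Site d) (hx : ∀ j, x j ∈ box d (L + 1)) :
    isingExpect (zdGraph d) (box d L) β 0 .plus (spinMonomial x) =
      (rcMeasure (boxGraph d (L + 1)) (fkIsingParam β) 2 (boxBoundary d (L + 1))).real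
        {ω | ∀ j, (¬ ∃ y ∈ boxBoundary d (L + 1), (Percolation.openGraph ω).Reachable ⟨x j, hx j⟩ y) →
          Even {i | (Percolation.openGraph ω).Reachable ⟨x j, hx j⟩ ⟨x i, hx i⟩}.ncard} := by
  classical
  have hp : fkIsingParam β ∈ Set.Icc (0 : ℝ) 1 := fkIsingParam_mem_Icc hβ
  rw [isingExpect_plus_box_spinMonomial_eq_rcMeasure_touch hd hβ L x hx]
  have hmono : ∀ ω : Finset (Sym2 (BoxV d (L + 1))), ∀ u v : BoxV d (L + 1),
      (Percolation.openGraph (↑(ω ∩ touchEdges d L) :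
        Percolation.BondConfig (BoxV d (L + 1)))).Reachable u v →
      (Percolation.openGraph (↑ω : Percolation.BondConfig (BoxV d (L + 1)))).Reachable u v := by
    intro ω u v huv
    refine huv.mono ?_
    unfold Percolation.openGraph
    exact fromEdgeSet_mono (Finset.coe_subset.2 Finset.inter_subset_left)
  have h := rcMeasure_real_eq_fromEdgeSet_of_outside_wired (boxGraph d (L + 1)) hp two_pos
    (boxBoundary d (L + 1)) (touchEdges d L) touchEdges_subset ?_
    (A := {ω | ∀ j, (¬ ∃ y ∈ boxBoundary d (L + 1),
        (Percolation.openGraph ω).Reachable ⟨x j, hx j⟩ y) →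
      Even {i | (Percolation.openGraph ω).Reachable ⟨x j, hx j⟩ ⟨x i, hx i⟩}.ncard}) ?_
  · rw [h]
    unfold touchGraph
    congr!
  · intro e he heT z hz
    rw [mem_boxBoundary_iff_notMem]
    intro hzn
    exact heT (by rw [touchEdges, Finset.mem_filter]; exact ⟨he, z, hz, hzn⟩)
  · intro ω hω
    have e1 : ∀ u : BoxV d (L + 1), (∃ y ∈ boxBoundary d (L + 1),
        (Percolation.openGraph (↑ω : Percolation.BondConfig (BoxV d (L + 1)))).Reachable u y) ↔
        ∃ y ∈ boxBoundary d (L + 1), (Percolation.openGraph (↑(ω ∩ touchEdges d L) :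
          Percolation.BondConfig (BoxV d (L + 1)))).Reachable u y := fun u =>
      ⟨exists_reachable_boxBoundary_inter_touchEdges hω,
        fun ⟨y, hy, huy⟩ => ⟨y, hy, hmono ω u y huy⟩⟩
    simp only [Set.mem_setOf_eq]
    refine forall_congr' fun j => ?_
    rw [← e1]
    refine imp_congr_right fun hj => ?_
    have e2 : {i | (Percolation.openGraph (↑ω : Percolation.BondConfig (BoxV d (L + 1)))).Reachable
        ⟨x j, hx j⟩ ⟨x i, hx i⟩} = {i | (Percolation.openGraph (↑(ω ∩ touchEdges d L) :
          Percolation.BondConfig (BoxV d (L + 1)))).Reachable ⟨x j, hx j⟩ ⟨x i, hx i⟩} := by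
      ext i
      exact ⟨reachable_inter_touchEdges_of_not_reachable_boxBoundary hω hj, hmono ω _ _⟩
    rw [e2]

end Box

end Literature.Probability.LatticeModels

end
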